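import Mathlib
import Literature.NumberTheory.LFunctions.MoebiusAutomaticCarry
import HarnessLib

/-!
# The carry property of `e(α s₂(n))` (Mauduit–Rivat 2009 Lemme 16 / 2015 Definition 1, base 2) — proved

Topic `Literature/NumberTheory/LFunctions`. Companion of `SumOfDigitsFourier.lean` (the Fourier
property) and of `MoebiusAutomaticCarry.lean` (the tree's form `HasCarryProperty k η C f` of
C. Mauduit, J. Rivat, J. Eur. Math. Soc. 17 (2015), Definition 1 = C. Müllner, Duke Math. J. 166
(2017), Def. 4.1, for GROUP-valued sequences with the quotient `f(x) f(y)⁻¹`). For the binary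
sum-of-digits function `s₂(u) = (Nat.digits 2 u).sum` and a real frequency `α`, the `Circle`-valued
phase `n ↦ 𝐞(α s₂(n))` (`𝐞 = Real.fourierChar`) has the carry property with `η = 1`, `C = 1`:

* `digitSum_mod_add_div` — `s₂(x) = s₂(x mod 2^P) + s₂(⌊x/2^P⌋)` [folklore];
* `not_mem_carryViolations_of_mod_ne` — if the `ρ` low digits of `ℓ` are not all `1`
  (`ℓ mod 2^ρ ≠ 2^ρ − 1`), then `ℓ` is no carry violation at scales `(λ, a, ρ)`: adding `n₂ < 2^a` to
  `y = ℓ2^a + n₁` cannot propagate a carry beyond digit `a + ρ`, so `⌊x/2^{a+ρ}⌋ = ⌊y/2^{a+ρ}⌋` and the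
  digit-sum differences of `(x, y)` and of their truncations agree;
* `card_carryViolations_exp_digitSum_le` — `#violations(λ, a, ρ) ≤ 2^{λ−ρ}`;
* `hasCarryProperty_exp_digitSum` — `HasCarryProperty 2 1 1 (𝐞(α s₂ ·))`.

This is the statement quoted by Mauduit–Rivat 2015, p. 2598 ("it follows from [MR2009, Lemmas 16
and 9] that `f(n) = e(α s_q(n))` has the carry property …"); Mauduit–Rivat, Acta Math. 203 (2009),
Lemme 16 is the original carry lemma for `s_q`. Only `q = 2` is treated. NOT here: general `q`, and
the (identical) statement for `ℂ`-valued phases, which follows by applying the unitary character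
`Circle → ℂ`.
-/

noncomputable section

namespace Literature.NumberTheory.LFunctions

open Finset
open scoped FourierTransform

namespace SumOfDigits

/-! ### Digit sums and truncation -/

/-- **Truncation splits the digit sum**: `s₂(x) = s₂(x mod 2^P) + s₂(⌊x/2^P⌋)`. [folklore] -/
theorem digitSum_mod_add_div : ∀ (P x : ℕ),
    (Nat.digits 2 x).sum = (Nat.digits 2 (x % 2 ^ P)).sum + (Nat.digits 2 (x / 2 ^ P)).sum
  | 0, x => by simp [Nat.mod_one]
  | P + 1, x => by
      -- the last binary digit splits off the digit sum: `s₂(2u + i) = i + s₂(u)` (`i < 2`)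
      have hsplit : ∀ (u i : ℕ), i < 2 → (Nat.digits 2 (2 * u + i)).sum = i + (Nat.digits 2 u).sum := by
        intro u i hi
        rcases Nat.eq_zero_or_pos (2 * u + i) with h0 | hpos
        · have hu : u = 0 := by omega
          have hi0 : i = 0 := by omega
          subst hu; subst hi0; simp
        · rw [Nat.digits_def' (by norm_num) hpos]
          have h1 : (2 * u + i) % 2 = i := by omega
          have h2 : (2 * u + i) / 2 = u := by omega
          rw [h1, h2, List.sum_cons]
      have hx : x = 2 * (x / 2) + x % 2 := (Nat.div_add_mod x 2).symm
      have hmod : x % 2 ^ (P + 1) = 2 * (x / 2 % 2 ^ P) + x % 2 := by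
        rw [pow_succ', Nat.mod_mul]; ring
      have hdiv : x / 2 ^ (P + 1) = x / 2 / 2 ^ P := by
        rw [pow_succ', Nat.div_div_eq_div_mul]
      conv_lhs => rw [hx]
      rw [hsplit _ _ (Nat.mod_lt _ (by norm_num)), hmod,
        hsplit _ _ (Nat.mod_lt _ (by norm_num)), hdiv, digitSum_mod_add_div P (x / 2)]
      ring

/-! ### The carry violations of `𝐞(α s₂)` -/

/-- **No carry, no violation.** At scales `(λ, a, ρ)`: if `ℓ mod 2^ρ ≠ 2^ρ − 1` then `ℓ` is not a carry
violation of `n ↦ 𝐞(α s₂(n))` — for `y = ℓ2^a + n₁`, `x = y + n₂` with `n₁, n₂ < 2^a` one has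
`⌊x/2^{a+ρ}⌋ = ⌊y/2^{a+ρ}⌋`, hence `s₂(x) − s₂(y) = s₂(x mod 2^{a+ρ}) − s₂(y mod 2^{a+ρ})`.
[cite: MauduitRivat2009, Lemme 16] -/
theorem not_mem_carryViolations_of_mod_ne (α : ℝ) {lam a ρ ℓ : ℕ} (hℓ : ℓ % 2 ^ ρ ≠ 2 ^ ρ - 1) :
    ℓ ∉ carryViolations 2 (fun n : ℕ => 𝐞 (α * ((Nat.digits 2 n).sum : ℕ))) lam a ρ := by
  rw [mem_carryViolations]
  rintro ⟨-, n₁, hn₁, n₂, hn₂, hne⟩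
  apply hne
  set P := a + ρ with hP
  set y := ℓ * 2 ^ a + n₁ with hy
  set x := ℓ * 2 ^ a + n₁ + n₂ with hxdef
  -- the quotients by `2^P` agree
  have hy_div : y / 2 ^ a = ℓ := by
    rw [hy, Nat.add_comm, Nat.add_mul_div_right _ _ (by positivity), Nat.div_eq_of_lt hn₁, zero_add]
  have hx_div_a : x / 2 ^ a = ℓ ∨ x / 2 ^ a = ℓ + 1 := by
    have h1 : x / 2 ^ a = ℓ + (n₁ + n₂) / 2 ^ a := by
      rw [hxdef, add_assoc, Nat.add_comm, Nat.add_mul_div_right _ _ (by positivity), Nat.add_comm]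
    set d := (n₁ + n₂) / 2 ^ a with hd
    have h2 : d < 2 := by
      have h2' : n₁ + n₂ < 2 * 2 ^ a := by omega
      exact (Nat.div_lt_iff_lt_mul (by positivity)).2 (by simpa [mul_comm] using h2')
    interval_cases d
    · left; simpa using h1
    · right; simpa using h1
  have hquot : x / 2 ^ P = y / 2 ^ P := by
    rw [hP, pow_add, ← Nat.div_div_eq_div_mul, ← Nat.div_div_eq_div_mul, hy_div]
    rcases hx_div_a with h | h
    · rw [h]
    · rw [h]
      -- `(ℓ+1)/2^ρ = ℓ/2^ρ` unless the low `ρ` digits of `ℓ` are all ones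
      have hρ : 0 < 2 ^ ρ := by positivity
      have hs : 2 ^ ρ - 1 + 1 = 2 ^ ρ := Nat.sub_add_cancel hρ
      have hlt : ℓ % 2 ^ ρ + 1 < 2 ^ ρ := by
        have := Nat.mod_lt ℓ hρ; omega
      have e1 : ℓ + 1 = 2 ^ ρ * (ℓ / 2 ^ ρ) + (ℓ % 2 ^ ρ + 1) := by
        have := Nat.div_add_mod ℓ (2 ^ ρ); omega
      rw [e1, Nat.mul_add_div hρ, Nat.div_eq_of_lt hlt, add_zero]
  -- hence the digit-sum differences agree
  have hsum : ((Nat.digits 2 x).sum : ℝ) - (Nat.digits 2 y).sum =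
      ((Nat.digits 2 (x % 2 ^ P)).sum : ℝ) - (Nat.digits 2 (y % 2 ^ P)).sum := by
    have ex := digitSum_mod_add_div P x
    have ey := digitSum_mod_add_div P y
    rw [hquot] at ex
    have : ((Nat.digits 2 x).sum : ℝ) + (Nat.digits 2 (y % 2 ^ P)).sum =
        (Nat.digits 2 (x % 2 ^ P)).sum + (Nat.digits 2 y).sum := by
      exact_mod_cast (by omega : (Nat.digits 2 x).sum + (Nat.digits 2 (y % 2 ^ P)).sum =
        (Nat.digits 2 (x % 2 ^ P)).sum + (Nat.digits 2 y).sum)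
    linarith
  -- and so do the phase quotients
  have key : ∀ u v u' v' : ℕ, ((Nat.digits 2 u).sum : ℝ) - (Nat.digits 2 v).sum =
      ((Nat.digits 2 u').sum : ℝ) - (Nat.digits 2 v').sum →
      𝐞 (α * ((Nat.digits 2 u).sum : ℕ)) * (𝐞 (α * ((Nat.digits 2 v).sum : ℕ)))⁻¹ =
        𝐞 (α * ((Nat.digits 2 u').sum : ℕ)) * (𝐞 (α * ((Nat.digits 2 v').sum : ℕ)))⁻¹ := by
    intro u v u' v' h
    rw [← AddChar.map_neg_eq_inv, ← AddChar.map_neg_eq_inv, ← AddChar.map_add_eq_mul,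
      ← AddChar.map_add_eq_mul]
    congr 1
    push_cast at h ⊢
    linear_combination α * h
  exact key x y (x % 2 ^ P) (y % 2 ^ P) hsum

/-- **Counting the violations**: at scales `(λ, a, ρ)` with `ρ ≤ λ`, the carry violations of
`𝐞(α s₂)` number at most `2^{λ−ρ}` (they are among the `ℓ < 2^λ` whose `ρ` low digits are all `1`).
[cite: MauduitRivat2009, Lemme 16] -/
theorem card_carryViolations_exp_digitSum_le (α : ℝ) {lam a ρ : ℕ} (hρ : ρ ≤ lam) :
    (carryViolations 2 (fun n : ℕ => 𝐞 (α * ((Nat.digits 2 n).sum : ℕ))) lam a ρ).card ≤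
      2 ^ (lam - ρ) := by
  classical
  -- violations ⊆ {ℓ < 2^λ : ℓ % 2^ρ = 2^ρ - 1}
  have hsub : carryViolations 2 (fun n : ℕ => 𝐞 (α * ((Nat.digits 2 n).sum : ℕ))) lam a ρ ⊆
      (range (2 ^ lam)).filter fun ℓ => ℓ % 2 ^ ρ = 2 ^ ρ - 1 := by
    intro ℓ hℓ
    have hℓ' := hℓ
    rw [mem_carryViolations] at hℓ'
    rw [mem_filter, mem_range]
    refine ⟨hℓ'.1, ?_⟩
    by_contra h
    exact not_mem_carryViolations_of_mod_ne α h hℓ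
  refine (card_le_card hsub).trans ?_
  -- `ℓ ↦ ℓ / 2^ρ` is injective on that set, into `range (2^(λ-ρ))`
  have hinj : Set.InjOn (fun ℓ : ℕ => ℓ / 2 ^ ρ)
      ((range (2 ^ lam)).filter fun ℓ => ℓ % 2 ^ ρ = 2 ^ ρ - 1 : Finset ℕ) := by
    intro ℓ₁ h₁ ℓ₂ h₂ h
    simp only [coe_filter, mem_range, Set.mem_setOf_eq] at h₁ h₂
    have e1 := Nat.div_add_mod ℓ₁ (2 ^ ρ)
    have e2 := Nat.div_add_mod ℓ₂ (2 ^ ρ)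
    simp only at h
    rw [← e1, ← e2, h, h₁.2, h₂.2]
  have hmaps : ∀ ℓ ∈ (range (2 ^ lam)).filter (fun ℓ => ℓ % 2 ^ ρ = 2 ^ ρ - 1),
      (fun ℓ : ℕ => ℓ / 2 ^ ρ) ℓ ∈ range (2 ^ (lam - ρ)) := by
    intro ℓ hℓ
    rw [mem_filter, mem_range] at hℓ
    rw [mem_range, Nat.div_lt_iff_lt_mul (by positivity), ← pow_add, Nat.sub_add_cancel hρ]
    exact hℓ.1
  calc ((range (2 ^ lam)).filter fun ℓ => ℓ % 2 ^ ρ = 2 ^ ρ - 1).card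
      ≤ (range (2 ^ (lam - ρ))).card := card_le_card_of_injOn _ hmaps hinj
    _ = 2 ^ (lam - ρ) := card_range _

/-- **The carry property of `𝐞(α s₂)`** (Mauduit–Rivat 2015 Definition 1 / Müllner 2017 Def. 4.1
in the tree's form `HasCarryProperty`, base `2`, `η = 1`, `C = 1`): for all `λ, a, ρ` with `ρ < λ`,
`#carryViolations(λ, a, ρ) ≤ 2^{λ − ρ}`. This is the property quoted by Mauduit–Rivat, JEMS 17
(2015), p. 2598, from Acta Math. 203 (2009), Lemme 16. [cite: MauduitRivat2009, Lemme 16] -/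
theorem hasCarryProperty_exp_digitSum (α : ℝ) :
    HasCarryProperty 2 1 1 (fun n : ℕ => 𝐞 (α * ((Nat.digits 2 n).sum : ℕ))) := by
  intro lam a ρ hρ
  have h := card_carryViolations_exp_digitSum_le α (a := a) hρ.le
  have h' : ((carryViolations 2 (fun n : ℕ => 𝐞 (α * ((Nat.digits 2 n).sum : ℕ))) lam a ρ).card : ℝ)
      ≤ (2 : ℝ) ^ (lam - ρ) := by exact_mod_cast h
  refine h'.trans (le_of_eq ?_)
  rw [one_mul, one_mul, Nat.cast_ofNat, ← Nat.cast_sub hρ.le, Real.rpow_natCast]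

end SumOfDigits

end Literature.NumberTheory.LFunctions
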